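import Summits.CriticalPhenomena.SAWScalingLimit.Theses.SAWLoopFugacityFlow
import Summits.CriticalPhenomena.SAWScalingLimit.Theorems.SimpleSubseqLimits.Negative.SimpleSubseqLimitsCore
import Summits.CriticalPhenomena.SAWScalingLimit.Theorems.SAWLoopFugacityFlowSimpleSubseqLimitsStubShadowPassage
import Summits.CriticalPhenomena.SAWScalingLimit.Theorems.SAWLoopFugacityFlowSimpleSubseqLimitsStubRangeIsArc
import Summits.CriticalPhenomena.SAWScalingLimit.Theorems.SimpleSubseqLimits.Negative.SimpleSubseqLimitsNecessary
import Literature.Probability.RandomPlanarGeometry.LoewnerRegularCurves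
import Literature.Probability.RandomPlanarGeometry.HullSubdomainPullback
import Literature.Probability.RandomPlanarGeometry.CaratheodoryHalfPlaneProofs
import Literature.Probability.RandomPlanarGeometry.RestrictionHullsProofs
import Literature.Probability.RandomPlanarGeometry.RestrictionHullsRiemannProofs
import Literature.Probability.RandomPlanarGeometry.SLEExistenceNeEightHolds
import Literature.Probability.RandomPlanarGeometry.JordanDomainProofs
import Summits.CriticalPhenomena.SAWScalingLimit.Theorems.SAWLoopFugacityFlowSimpleSubseqLimitsPSStubDecomposition
import Summits.CriticalPhenomena.SAWScalingLimit.Theorems.SAWLoopFugacityFlowSimpleSubseqLimitsPSRootReturnPinned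
import Summits.CriticalPhenomena.SAWScalingLimit.Theorems.SAWLoopFugacityFlowSimpleSubseqLimitsPSShadowDecayPinned
import HarnessLib.Audit

/-!
# Line `past-shadowing-costs-halves` — skeleton for the crux `SimpleSubseqLimits`, RESHAPED by the
# line lead (prover-line-stmt-CriticalPhenomena-4982-c1, 2026-08-16): ROOT-FREE DECOMPOSITION

**STATUS (lead c1, cycle 2).** Exactly TWO `sorry`s remain, the line's two OPEN lattice inputs
`stub_rootReturn : RootReturn` and `stub_slitShadowDecay : SlitShadowDecay` (crux-sized; no technique
in print at `x_c`). Everything else is LANDED under `Theorems/` and discharged here by `exact`: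
`stub_decomposition` (…PSStubDecomposition p110303; Clock p105021, Core p105542),
`stub_rootReturnPinned` (…PSRootReturnPinned: both inputs pinned BOTH ways — `inputs_of_sawScalingLimit`,
`inputs_of_crux`), `stub_shadowDecayPinned` (…PSShadowDecayPinned p110273), the forbidden-set domain
Markov property (…StubForbiddenDomainMarkov p110397, step 1 of any G-type proof of stub 2), and the
line's MAIN THEOREM `PastShadowing.Main.line_main` (…PSLine). §7 records the upshot:
`crux_iff_inputs : EventualTight → A-side → (SimpleSubseqLimits ↔ RootReturn ∧ SlitShadowDecay)`.

**Reshape (lead c1).** The planner's chain `NRB → ShadowDecayBdry → (rootReduction by leashes) →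
ShadowDecay` is replaced, because the leash union bound fails for roots at mesoscopic depth (a bulk
start at depth `d ≫ δ` winds around its root with probability bounded below, and a half-turn crosses
every leash). New ORDER chain (registered stubs `stub_rootReturn`, `stub_slitShadowDecay` — the two
open lattice inputs — and `stub_decomposition`; the passage `ShadowDecay → NoShadowing` and SHAPE
are now THEOREMS of this file, glued from the landed siblings `ShadowPassage.stub_shadowPassage`
(second lead of `marked-point-revisit`, v2) and `ArcRangeGlue.stub_rangeIsArc` (first lead)):
condition on the walk up to its LAST EXIT from `B̄(a, ρ₀)` (not a stopping time: the future then
avoids the ball, which becomes part of the slit domain, so the remaining law is a plain `x_c`-SAW law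
in a simply connected slit graph whose root is boundary-attached — interior `a_δ` or not); on the
complement of the root-return event (`RootReturn`: no return to `B̄(a, ρ₀)` after reaching distance
`r₀`, the one irreducible interior-root input, summit-implied) the explored prefix is microscopic
(`⊆ B(a, r₀)`, `r₀ ≤ η/64`), so an `ε`-near shadowing of an `η`-stretch by the whole polyline contains
an `ε`-near shadowing of an `η/4`-stretch by the SUFFIX polyline of its own past
(`stub_decomposition`, deterministic + a union bound), which the slit bound `SlitShadowDecay`
(the UNCONDITIONAL probability that the remaining polyline shadows its own later past, `ε`
depending on `D`; summit-implied; the output of a KS Prop. 3.7-type chain from a G1 bound over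
boundary-rooted slit laws with arbitrary targets — the open G-type input) controls. SHAPE, the
class-level passage and the deterministic glue are unchanged.

# (planner's original module docstring follows)
# Line `past-shadowing-costs-halves` — skeleton for the crux `SimpleSubseqLimits`
(stmt-CriticalPhenomena-4982; decl
`Summit.CriticalPhenomena.SAWScalingLimit.Theses.SAWLoopFugacityFlow.SimpleSubseqLimits`, shared
VERBATIM by the routes SAWSteinDefect / SAWTensorRG / SAWFrontierHomotopy)

Crux-plan (round 1, 2026-08-16) of the idea card `Cruxes/SimpleSubseqLimits/Ideas/past-shadowing-costs-halves.md`
(ideator 1; triage r1: pass ×3, merged with `hugging-release` — same lever).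

## The line

The crux says: every subsequential weak limit `ν` of the critical `δℤ²` SAW laws of a Dobrushin
domain is carried by SIMPLE chords `a → b` in `cl D` meeting `∂D` only at `a, b`.  By the landed
negative lemma `Negative.simpleSubseqLimits_iff_core` (p74405) the endpoint and confinement clauses
are FREE, so the crux is `ν`-a.s. (simple ∧ boundary-avoiding).  The line splits this into

* SHAPE (`RangeArc`): `ν`-a.s. the RANGE of the class is a simple arc `a → b` meeting `∂D` only at
  `a, b` — fed by the hull-avoidance VALUES of the limit (`AvoidanceValues`: `ν` and the chordal
  SLE(8/3) law agree on `{range ⊆ cl D'}` for every hull subdomain `D'`; PROVED here from the route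
  items `AvoidanceLimit`, `AvoidancePassage`, `SLEAvoidanceValue` — `avoidanceValues_of_routeItems`)
  plus the filled-set transport (triage F5/S1) = `stub_rangeArc`;
* ORDER (`NoShadowing`): `ν`-a.s. no representative ever TRAVELS ALONG ITS OWN PAST — after a time
  `s₀`, through a stretch of displacement `≥ η`, on the trace of `γ[0, s₀]` at distance `≥ ρ` from
  `γ s₀` (`Shadows`, `shadowEvent`).  This is the card's lever, delivered by a lattice chain:
  `stub_nearReturnBound` (NRB, the INPUT: an unforced inward approach within `r` of a point of the
  own past, observed from distance `≥ C r`, has conditional probability `≤ ½` — the near-return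
  instances of Kemppainen–Smirnov's Condition G2 for the critical SAW, typed DIRECTLY on the
  conditional laws of `SAW.law` with graph-level avoidability in the slit graph and a BOUNDARY-ROOTED
  start, so neither the vacuous-antecedent artefact of stmt-0791 (triage F1) nor the family-transfer
  gap (F4) can occur) → `stub_shadowChain` (THE LEVER: `≍ η/ε` such approaches, anchored at stopping
  times, each costing `½`: `P_δ(ε-near-shadowing) ≤ θ` eventually in `δ`, for boundary-rooted
  starts) → `stub_rootReduction` (interior lattice roots, triage F2/S2) → `stub_limitPassage`
  (open thickenings + portmanteau + `ε → 0`).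
* GLUE (PROVED, no sorry): for `ν`-a.e. class take a LIGHT representative
  (`Curve.exists_light_of_ne`); no shadowing ⇒ the range strictly grows on every parameter interval
  (`strictGrowth_of_not_shadows`); with the arc range this forces injectivity by the argmax lemma
  `simple_of_arc_range_of_strictGrowth` (ideator 3's kernel-checked lemma, vendored verbatim);
  hence `mem_simple_of_arc_of_notMem_shadowEvent` and the composition `SimpleSubseqLimits_of`.

## Registered stubs (5; the only sorries of the file)

* `stub_rangeArc       : AvoidanceValues → RangeArc`                 (SHAPE transport, M–L, provable now)
* `stub_nearReturnBound : NearReturnBound`                          (lattice INPUT, open — hardest)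
* `stub_shadowChain    : NearReturnBound → ShadowDecayBdry`         (THE LEVER, L)
* `stub_rootReduction  : ShadowDecayBdry → ShadowDecay`             (interior roots, M–L)
* `stub_limitPassage   : ShadowDecay → NoShadowing`                 (portmanteau, M, provable now)

`SimpleSubseqLimits_of` (sorry-free) takes the five stub statements BY THEIR REGISTERED NAMES
(`Registered.stub_…`, the alias device of `Cruxes/BoundaryClosure/Lines/two-root-quotient.lean`)
together with the three ROUTE ITEMS `AvoidanceLimit` (stmt-10649, the route's rank-2 crux),
`AvoidancePassage` (stmt-4984) and `SLEAvoidanceValue` (stmt-10651) by name — admissible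
obligations of the skeleton audit — and concludes the crux decl BY NAME.  Honest reading: like
every line on this crux (triage S1: "S dissolves only relative to A"), the line proves
`SimpleSubseqLimits` from the avoidance crux of the route plus its own five stubs.

## Disproof used (`Cruxes/SimpleSubseqLimits/Disproof.lean`, cdisprove gen 1, and the landed
`Theorems/SimpleSubseqLimits/Negative/*`)

* §5 `crux_iff_core` = landed `Negative.simpleSubseqLimits_iff_core` and
  `ae_source_target_range_of_weakLimitAlong`: IMPORTED and used in `SimpleSubseqLimits_of`
  (endpoints / confinement are free; the line proves only simple ∧ boundary-avoiding).
* §2 `simpleSubseqLimits_false_without_tendsto_fst/snd`: both endpoint limits are used — through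
  the free clauses (source = a ≠ b = target gives the non-constant class needed for the light
  representative) and inside `stub_rangeArc` (SHAPE).
* §4 `simple_not_isClosed` / `exists_weakLimit_not_ae_simple`: no soft road — ORDER is a
  quantitative lattice input (NRB) passed to the limit on OPEN events (`nearShadowEvent`).
* §7 range-blindness (`exists_simple_and_not_simple_same_range`): exactly why ORDER is a separate
  path-level statement; `RangeArc` alone is not claimed to give simplicity.
* §9 criticality (`cruxAt_false_of_supercritical_limit`): every lattice statement is about
  `SAW.law` at `x_c`; NRB is false for `x > x_c` (space-filling walks return to their past),
  honoured by construction (barrier `SupercriticalSAWSpaceFilling*`).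
* §1/§10: junk laws (total mass 0) satisfy every lattice inequality trivially; no finite-mesh
  version of the carrier clause is asserted.
* negatives index (`ledger negatives --problem CriticalPhenomena`, 8 entries): none on simplicity;
  stmt-0772 (all-δ tightness) untouched — everything here is eventual in `δ`.
-/

noncomputable section

open MeasureTheory Filter Topology Set Metric Function
open Literature.Probability.RandomPlanarGeometry Literature.Probability.RandomPlanarGeometry.SAW
open Literature.Probability.LatticeModels
open scoped ENNReal NNReal BoundedContinuousFunction unitInterval

namespace Summit.CriticalPhenomena.SAWScalingLimit.Cruxes.SimpleSubseqLimits.PastShadowingCostsHalves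

open Summit.CriticalPhenomena.SAWScalingLimit.Theses.SAWLoopFugacityFlow
  (SimpleSubseqLimits AvoidanceLimit AvoidancePassage SLEAvoidanceValue EventualTight)
open Summit.CriticalPhenomena.SAWScalingLimit.Theorems.SimpleSubseqLimits.Negative
  (WeakLimitAlong simpleSubseqLimits_iff_core ae_source_target_range_of_weakLimitAlong)

/-! ## §1 Limit-level statements -/

/-- **Hull-avoidance values of subsequential limits** (route-neutral form of the SHAPE input):
for every subsequential weak limit `ν` of the critical SAW laws along an endpoint approximation
there is a chordal SLE(8/3) law `μ` of `(D; a, b)` such that `ν` and `μ` give the same mass to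
`{range ⊆ closure D'}` for every hull subdomain `D'` (same marked points, agreeing with `D` in balls
around `a` and `b` — the inline form of the route items).  In route SAWLoopFugacityFlow /
SAWSteinDefect this is `AvoidanceLimit` + `AvoidancePassage` + `SLEAvoidanceValue`
(`avoidanceValues_of_routeItems`, proved below); SAWTensorRG / SAWFrontierHomotopy feed it from
their own avoidance cruxes. -/
def AvoidanceValues : Prop :=
  ∀ (D : DobrushinDomain) (a b : ℝ → Site 2), IsEndpointApprox D a b →
    ∀ (s : ℕ → ℝ) (ν : Measure (CurveClass ℂ)), Tendsto s atTop (𝓝[>] (0 : ℝ)) →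
      IsProbabilityMeasure ν → WeakLimitAlong D a b s ν →
        ∃ μ : Measure (CurveClass ℂ), IsSLELaw ((8 : ℝ≥0) / 3) D μ ∧
          ∀ D' : DobrushinDomain, D'.carrier ⊆ D.carrier → D'.pt 0 = D.pt 0 → D'.pt 1 = D.pt 1 →
            (∃ ε : ℝ, 0 < ε ∧ D'.carrier ∩ ball (D.pt 0) ε = D.carrier ∩ ball (D.pt 0) ε ∧
              D'.carrier ∩ ball (D.pt 1) ε = D.carrier ∩ ball (D.pt 1) ε) →
            ν (CurveClass.rangeSubset (closure D'.carrier)) =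
              μ (CurveClass.rangeSubset (closure D'.carrier))

/-- **SHAPE** (`RangeArc`): for every subsequential weak limit `ν`, `ν`-a.e. curve class has the
RANGE of a simple arc from `a = D.pt 0` to `b = D.pt 1` (an injective continuous `e : I → ℂ` with
`range e = range c`) and its range meets `∂D` only at `a, b`.  (Endpoints and `range ⊆ cl D` are
free: `Negative.ae_source_target_range_of_weakLimitAlong`.) -/
def RangeArc : Prop :=
  ∀ (D : DobrushinDomain) (a b : ℝ → Site 2), IsEndpointApprox D a b →
    ∀ (s : ℕ → ℝ) (ν : Measure (CurveClass ℂ)), Tendsto s atTop (𝓝[>] (0 : ℝ)) →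
      IsProbabilityMeasure ν → WeakLimitAlong D a b s ν →
        ∀ᵐ c ∂ν, (∃ e : C(I, ℂ), Injective e ∧ range e = c.range ∧ e 0 = D.pt 0 ∧ e 1 = D.pt 1) ∧
          c.range ∩ frontier D.carrier ⊆ {D.pt 0, D.pt 1}

/-- `γ` **`(η, ρ)`-shadows its own past**: after some time `s₀` it travels through a stretch
`[t, t']` of displacement `≥ η` every point of which was already visited before `s₀` at a point at
distance `≥ ρ` from `γ s₀` ("travelling along the own past outside the `ρ`-ball at the tip"). -/
def Shadows (γ : Curve ℂ) (η ρ : ℝ) : Prop :=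
  ∃ s₀ t t' : I, s₀ ≤ t ∧ t ≤ t' ∧ η ≤ dist (γ t) (γ t') ∧
    ∀ u : I, t ≤ u → u ≤ t' → γ u ∈ γ '' {v : I | v ≤ s₀ ∧ ρ ≤ dist (γ v) (γ s₀)}

/-- The event "some representative `(η, ρ)`-shadows its own past" on curve classes. -/
def shadowEvent (η ρ : ℝ) : Set (CurveClass ℂ) :=
  {c | ∃ γ : Curve ℂ, CurveClass.mk γ = c ∧ Shadows γ η ρ}

/-- Lattice-visible **`ε`-near shadowing**: after `s₀`, a stretch of displacement `> η` stays
within (open) distance `ε` of past points at distance `> ρ` from `γ s₀` (strict inequalities: an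
OPEN event, see `stub_limitPassage`). -/
def NearShadows (γ : Curve ℂ) (η ρ ε : ℝ) : Prop :=
  ∃ s₀ t t' : I, s₀ ≤ t ∧ t ≤ t' ∧ η < dist (γ t) (γ t') ∧
    ∀ u : I, t ≤ u → u ≤ t' → ∃ v : I, v ≤ s₀ ∧ ρ < dist (γ v) (γ s₀) ∧ dist (γ u) (γ v) < ε

/-- The event "some representative `ε`-nearly `(η, ρ)`-shadows its own past". -/
def nearShadowEvent (η ρ ε : ℝ) : Set (CurveClass ℂ) :=
  {c | ∃ γ : Curve ℂ, CurveClass.mk γ = c ∧ NearShadows γ η ρ ε}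

/-- **ORDER** (`NoShadowing`): every subsequential weak limit gives mass `0` to shadowing, for all
thresholds `η, ρ > 0`. True for measures carried by simple classes; fails on a Z-fold. -/
def NoShadowing : Prop :=
  ∀ (D : DobrushinDomain) (a b : ℝ → Site 2), IsEndpointApprox D a b →
    ∀ (s : ℕ → ℝ) (ν : Measure (CurveClass ℂ)), Tendsto s atTop (𝓝[>] (0 : ℝ)) →
      IsProbabilityMeasure ν → WeakLimitAlong D a b s ν →
        ∀ η ρ : ℝ, 0 < η → 0 < ρ → ν (shadowEvent η ρ) = 0

/-- **Discrete shadow decay at `(D; a_δ, b_δ)`**: for all thresholds `η, ρ` and every target `θ`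
there is a width `ε > 0` (depending on `D`: a domain with an `η`-long corridor of width `< ε`
forces near-shadowing, so NO domain-uniform version is true) such that for all small meshes the
critical SAW `ε`-nearly shadows an `η`-stretch of its `ρ`-far past with probability `≤ θ`.  The
chain gives the rate `θ = K(ε, ρ, D) · 2^{-c η / ε}`; only `θ → 0` is consumed. -/
def ShadowDecayAt (D : DobrushinDomain) (a b : ℝ → Site 2) : Prop :=
  ∀ η ρ θ : ℝ, 0 < η → 0 < ρ → 0 < θ → ∃ ε : ℝ, 0 < ε ∧
    ∀ᶠ δ in 𝓝[>] (0 : ℝ),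
      law D.carrier δ (a δ) (b δ) {γ | γ.curve ∈ nearShadowEvent η ρ ε} ≤ ENNReal.ofReal θ

/-- Shadow decay along EVERY endpoint approximation (interior lattice roots allowed). -/
def ShadowDecay : Prop :=
  ∀ (D : DobrushinDomain) (a b : ℝ → Site 2), IsEndpointApprox D a b → ShadowDecayAt D a b

/-! ## §2 Lattice vocabulary: root returns, last exits; the two lattice inputs -/

section Lattice

variable {Ω : Set ℂ} {δ : ℝ} {u v : Site 2}

/-- **Root return** (vertex level): the walk has a vertex at distance `≥ r` from the point `c` and a
LATER vertex at distance `≤ ρ₀` from `c` — it comes back to the `ρ₀`-ball about `c` after having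
reached distance `r`. Used with `c = a = D.pt 0`, the root-side marked point. -/
def RootReturns (γ : DomainSAW Ω δ u v) (c : ℂ) (ρ₀ r : ℝ) : Prop :=
  ∃ i j : ℕ, i < j ∧ j ≤ γ.length ∧ r ≤ dist (meshPoint δ (γ.walk.getVert i)) c ∧
    dist (meshPoint δ (γ.walk.getVert j)) c ≤ ρ₀

/-- **Last exit from `B̄(c, ρ₀)` at index `k`, with a microscopic prefix**: vertex `k` lies in the
closed `ρ₀`-ball about `c`, no later vertex does, and all vertices up to `k` lie in the open
`r₀`-ball. Conditionally on this event (and any `𝓕_k`-event) the remaining walk is the critical SAW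
of the slit graph `Ω_δ ∖ (B̄(c, ρ₀) ∪ γ[0, k))` from `γ_k` — a boundary-ATTACHED root, whatever the
depth of the original root `u`. -/
def LastExitAt (γ : DomainSAW Ω δ u v) (c : ℂ) (ρ₀ r₀ : ℝ) (k : ℕ) : Prop :=
  k ≤ γ.length ∧ dist (meshPoint δ (γ.walk.getVert k)) c ≤ ρ₀ ∧
    (∀ j : ℕ, k < j → j ≤ γ.length → ρ₀ < dist (meshPoint δ (γ.walk.getVert j)) c) ∧
    ∀ i : ℕ, i ≤ k → dist (meshPoint δ (γ.walk.getVert i)) c < r₀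

/-- The polyline of the REMAINING walk after `k` steps (through the mesh points of
`γ_k, γ_{k+1}, …`; junk = the whole polyline's tail conventions of `Walk.drop`). -/
def suffixCurve (γ : DomainSAW Ω δ u v) (k : ℕ) : Curve ℂ :=
  ⟨(γ.walk.drop k).toCurve (meshPoint δ)⟩

/-- The polyline of the whole walk (the canonical representative of `γ.curve`). -/
def latticeCurve (γ : DomainSAW Ω δ u v) : Curve ℂ :=
  ⟨γ.walk.toCurve (meshPoint δ)⟩

/-- The class of the lattice polyline is the SAW's curve class (definitional). -/
@[simp] theorem mk_latticeCurve (γ : DomainSAW Ω δ u v) : CurveClass.mk (latticeCurve γ) = γ.curve := rfl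

end Lattice

/-- **ROOT RETURN DECAY** (the line's root-side lattice INPUT; interior roots allowed): for every
Dobrushin domain and endpoint approximation, every `r > 0` and `θ > 0` there is `ρ₀ ∈ (0, r)` such
that for all small `δ` the critical SAW returns to `B̄(a, ρ₀)` (`a = D.pt 0`) after having reached
distance `r` from `a` only with probability `≤ θ`. For boundary roots this is an unforced inward
approach to a boundary pocket (G1-chargeable, `(ρ₀/r)^Δ`); for interior roots (depth `→ 0`) it is a
statement about island pasts at scales above the depth. Implied by the summit conjecture (the event
is closed and shrinks to {the curve revisits its source}, null for chordal SLE(8/3)); necessary for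
the crux given `EventualTight`. -/
def RootReturn : Prop :=
  ∀ (D : DobrushinDomain) (a b : ℝ → Site 2), IsEndpointApprox D a b →
    ∀ r θ : ℝ, 0 < r → 0 < θ → ∃ ρ₀ : ℝ, 0 < ρ₀ ∧ ρ₀ < r ∧
      ∀ᶠ δ in 𝓝[>] (0 : ℝ),
        law D.carrier δ (a δ) (b δ) {γ | RootReturns γ (D.pt 0) ρ₀ r} ≤ ENNReal.ofReal θ

/-- **SLIT SHADOW DECAY** (the line's G-type lattice INPUT; an UNCONDITIONAL probability of the
original law): for every Dobrushin domain, endpoint approximation, thresholds `η, ρ, θ` and ball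
pair `0 < ρ₀ < r₀` with `64 r₀ ≤ η`, there is `ε > 0` (depending on `D`: a fjord of `∂D` of width
`< ε` and depth `≥ η` would force near-shadowing; a Jordan boundary has none for small `ε`) such
that for all small `δ`: with probability `≤ θ` the walk has a last exit from `B̄(a, ρ₀)` with its
prefix inside `B(a, r₀)` AND its REMAINING polyline `ε`-nearly `(η, ρ)`-shadows its own past.
Conditionally on the last-exit data (index `k`, prefix) the remaining walk is the critical SAW of
the simply connected slit graph `Ω_δ ∖ (B̄(a, ρ₀) ∪ γ[0, k))` from a boundary-ATTACHED root to
`b_δ` (exact domain Markov for last-exit conditioning: the future avoids the ball, which joins the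
slit domain) — so a G-type proof charges the shadowing stretch by a Kemppainen–Smirnov
Prop. 3.7-type chain of halves from a Condition-G1 bound on boundary-rooted slit SAW laws with
arbitrary targets, uniformly over the microscopic slits (cf. the planner's `NearReturnBound`,
`SAWParafermion.KSAdmissibleG1`); no technology proves it at `n = 0`; false for `x > x_c`.
Implied by the summit conjecture (the thickened events shrink to {the SLE(8/3) curve after its
last exit from the ball travels along its own later past}, a null event for a simple curve). -/
def SlitShadowDecay : Prop :=
  ∀ (D : DobrushinDomain) (a b : ℝ → Site 2), IsEndpointApprox D a b →
    ∀ η ρ θ ρ₀ r₀ : ℝ, 0 < η → 0 < ρ → 0 < θ → 0 < ρ₀ → ρ₀ < r₀ → 64 * r₀ ≤ η →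
      ∃ ε : ℝ, 0 < ε ∧ ∀ᶠ δ in 𝓝[>] (0 : ℝ),
        law D.carrier δ (a δ) (b δ)
            {γ | ∃ k : ℕ, LastExitAt γ (D.pt 0) ρ₀ r₀ k ∧ NearShadows (suffixCurve γ k) η ρ ε} ≤
          ENNReal.ofReal θ

/-- **Polyline-level shadow decay** (what the decomposition delivers): as `ShadowDecayAt`, but for
the event that the lattice POLYLINE itself `ε`-nearly shadows its past. -/
def PolylineShadowDecay : Prop :=
  ∀ (D : DobrushinDomain) (a b : ℝ → Site 2), IsEndpointApprox D a b →
    ∀ η ρ θ : ℝ, 0 < η → 0 < ρ → 0 < θ → ∃ ε : ℝ, 0 < ε ∧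
      ∀ᶠ δ in 𝓝[>] (0 : ℝ),
        law D.carrier δ (a δ) (b δ) {γ | NearShadows (latticeCurve γ) η ρ ε} ≤ ENNReal.ofReal θ

/-! ## §3 The three registered stubs (the only sorries of this file) -/

/-- **stub 1 — ROOT RETURN DECAY (open lattice input; root-type).** See `RootReturn`. Pinned:
implied by the summit conjecture and necessary for the crux given `EventualTight`
(`Theorems/SAWLoopFugacityFlowSimpleSubseqLimitsPSRootReturnPinned.lean`). -/
theorem stub_rootReturn : RootReturn := by
  sorry

/-- **stub 2 — SLIT SHADOW DECAY (open lattice input; G-type, boundary-rooted slit laws).** See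
`SlitShadowDecay`. Weaker than the sibling input `ShadowDecay` (its event is a sub-event of the
whole-polyline near-shadowing event), hence also summit-implied. -/
theorem stub_slitShadowDecay : SlitShadowDecay := by
  sorry

/-- **stub 3 — THE DECOMPOSITION (M–L; PROVED by the lead, lands as
`Theorems/SAWLoopFugacityFlowSimpleSubseqLimitsPSStubDecomposition{Clock,Core,}.lean`).**
`RootReturn → SlitShadowDecay → PolylineShadowDecay`: fix `η, ρ, θ`; put `r₀ := η/256`, get
`ρ₀ < r₀` from `RootReturn` at `(r₀, θ/2)` and `ε₀` from `SlitShadowDecay` at `(η/4, ρ, θ/2, ρ₀, r₀)`,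
`ε := min ε₀ r₀`. Every walk starts inside `B̄(a, ρ₀)` for small `δ` (`δ·a_δ → a`), so it has a last
exit index `k` from that ball; off the root-return event all vertices up to `k` lie in `B(a, r₀)`
(else `(i, k)` is a root return), i.e. `LastExitAt … k`. DETERMINISTIC CORE: if the whole polyline
`ε`-nearly `(η, ρ)`-shadows its past with data `s₀ ≤ t ≤ t'` while its prefix up to vertex `k` lies in
`B(a, r₀)` and `r₀ + ε < η/4`, then (i) `s₀` is past vertex `k`'s time (else every point of the stretch
is within `ε` of `B(a,r₀)` and the stretch has displacement `≤ 2(r₀+ε) < η`); (ii) the initial piece of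
the stretch up to its first entrance into `B̄(a, r₀+ε)`, or its final piece after the last exit, or
the whole stretch, has displacement `> η/2 − (r₀+ε) ≥ η/4` and stays at distance `≥ r₀+ε` from `a`, so
each of its points shadows a past point at distance `> r₀` from `a`, hence a point of the SUFFIX past;
(iii) the suffix polyline `(γ.walk.drop k).toCurve` is the whole polyline restricted to
`[dyadicTime k, 1]` affinely reparametrised (the dyadic `Path.trans` clock of `polyline`,
`PolylineDyadicClock.lean`), so it `ε`-nearly `(η/4, ρ)`-shadows its own past. UNION BOUND:
`P(NearShadows) ≤ P(RootReturns) + P(∃ k, LastExitAt k ∧ suffix shadows) ≤ θ/2 + θ/2`. -/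
theorem stub_decomposition : RootReturn → SlitShadowDecay → PolylineShadowDecay := by
  exact Summit.CriticalPhenomena.SAWScalingLimit.Theorems.SimpleSubseqLimits.PastShadowing.Decomposition.stub_decomposition


/-! ## §3c Registered anchors of the lead's helper files (each is the statement by which a
theorem-only support file of `stub_decomposition` / the pinning of `RootReturn` is keyed; closed by
`exact` once the file lands) -/

/-- Anchor of `…PSStubDecompositionClock.lean` (part 1 of `stub_decomposition`): the affine tail
clock `1 - 2^{-k} + 2^{-k} τ` lands in the unit interval. -/
theorem stub_decompositionClock :
    ∀ (k : ℕ) (τ : I), 1 - (1 / 2 : ℝ) ^ k + (1 / 2 : ℝ) ^ k * (τ : ℝ) ∈ I := by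
  exact Summit.CriticalPhenomena.SAWScalingLimit.Theorems.SimpleSubseqLimits.PastShadowing.Clock.stub_decompositionClock

/-- Anchor of `…PSStubDecompositionCore.lean` (part 2 of `stub_decomposition`, the deterministic
core, with the time threshold forgotten): prefix inside `B(a, r₀)` up to time `T`, `0 < ε`,
`r₀ + ε < η/4`, `ε`-near `(η, ρ)`-shadowing ⇒ `ε`-near `(η/4, ρ)`-shadowing. -/
theorem stub_decompositionCore :
    ∀ (γ : Curve ℂ) (a : ℂ) (r₀ ε η ρ : ℝ) (T : I), (∀ s : I, s ≤ T → dist (γ s) a < r₀) →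
      0 < ε → r₀ + ε < η / 4 → NearShadows γ η ρ ε → NearShadows γ (η / 4) ρ ε := by
  exact Summit.CriticalPhenomena.SAWScalingLimit.Theorems.SimpleSubseqLimits.PastShadowing.Core.stub_decompositionCore

/-- Anchor of `…PSRootReturnPinned.lean`: the root-side input is implied by the summit conjecture
(so it is not over-strong). -/
theorem stub_rootReturnPinned : _root_.SAWScalingLimit → RootReturn := by
  exact Summit.CriticalPhenomena.SAWScalingLimit.Theorems.SimpleSubseqLimits.PastShadowing.RootReturnPinned.stub_rootReturnPinned

/-- Anchor of `…PSShadowDecayPinned.lean`: the sibling input `ShadowDecay` (of which stub 2 is a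
sub-event bound, `RootReturnPinned.slitShadowDecay_of_shadowDecay`) is implied by the summit
conjecture; the same file proves it NECESSARY for the crux given `EventualTight`
(`shadowDecay_of_crux`), so both lattice inputs of this line are pinned from both sides. -/
theorem stub_shadowDecayPinned : _root_.SAWScalingLimit → ShadowDecay := by
  exact Summit.CriticalPhenomena.SAWScalingLimit.Theorems.SimpleSubseqLimits.PastShadowing.ShadowDecayPinned.stub_shadowDecayPinned

/-! ## §3b Proved: SHAPE and the limit passage, glued from the landed siblings -/

/-- **SHAPE** (`AvoidanceValues → RangeArc`), glued from the first lead's LANDED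
`ArcRangeGlue.stub_rangeIsArc` (p91256): the hull-avoidance values produce an SLE(8/3) law `μ`
agreeing with `ν` on all hull-subdomain avoidance events; `μ` is a probability measure carried by
simple chords (`Negative.ae_carrier_of_isSLELaw`), the free clauses hold `ν`-a.e.
(`Negative.ae_source_target_range_of_weakLimitAlong`), and `HasArcRange` unpacks to an injective
continuous parametrisation of the common range with the right endpoints. [folklore] -/
theorem stub_rangeArc : AvoidanceValues → RangeArc := by
  intro hAV D a b hab s ν hs hν hw
  haveI := hν
  obtain ⟨μ, hμ, hagree⟩ := hAV D a b hab s ν hs hν hw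
  haveI : Fact Literature.Probability.Process.isProjectiveLimit_preWienerMeasure :=
    ⟨isProjectiveLimit_preWienerMeasure_holds⟩
  haveI := hμ.isProbabilityMeasure
  have hμcar := Summit.CriticalPhenomena.SAWScalingLimit.Theorems.SimpleSubseqLimits.Negative.ae_carrier_of_isSLELaw hμ
  have hfree := ae_source_target_range_of_weakLimitAlong (ν := ν) hab hs hw
  have h := Summit.CriticalPhenomena.SAWScalingLimit.Theorems.SimpleSubseqLimits.MarkedPointRevisit.ArcRangeGlue.stub_rangeIsArc
    D ν μ hν inferInstance hfree hμcar hagree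
  filter_upwards [h] with c hc
  obtain ⟨c', hc's, h0, h1, -, hfr, hrange⟩ := hc
  obtain ⟨e₀, he₀, rfl⟩ := hc's
  refine ⟨⟨e₀.toContinuousMap, he₀, ?_, ?_, ?_⟩, hrange ▸ hfr⟩
  · rw [← hrange]; rfl
  · change e₀ 0 = D.pt 0
    rw [← Curve.source_def, ← CurveClass.source_mk]; exact h0
  · change e₀ 1 = D.pt 1
    rw [← Curve.target_def, ← CurveClass.target_mk]; exact h1

/-- **LIMIT PASSAGE** (`ShadowDecay → NoShadowing`), glued from the second lead's LANDED
`ShadowPassage.stub_shadowPassage` (line `marked-point-revisit`, v2; its vocabulary is verbatim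
this file's). [folklore] -/
theorem stub_limitPassage : ShadowDecay → NoShadowing :=
  fun h D a b hab s ν hs hν hw η ρ hη hρ =>
    Summit.CriticalPhenomena.SAWScalingLimit.Theorems.SimpleSubseqLimits.MarkedPointRevisit.ShadowPassage.stub_shadowPassage
      D a b s ν (h D a b hab) ⟨hs, hν, hw⟩ η ρ hη hρ

/-! ## §4 Proved: the SHAPE input from the route items -/

/-- `ε`-ball agreement of `D'` with `D` at `p` keeps `p` off `closure (D ∖ D')` (the inline hull
condition of the route items implies `MarkedDomain.IsHullSubdomain`). [folklore] -/
theorem notMem_closure_diff_of_ball_eq {D D' : DobrushinDomain} {p : ℂ} {ε : ℝ} (hε : 0 < ε)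
    (h : D'.carrier ∩ ball p ε = D.carrier ∩ ball p ε) :
    p ∉ closure (D.carrier \ D'.carrier) := by
  rw [Metric.mem_closure_iff]
  push Not
  refine ⟨ε, hε, fun x hx => ?_⟩
  by_contra hlt
  push Not at hlt
  have hxball : x ∈ D.carrier ∩ ball p ε := ⟨hx.1, by rw [mem_ball, dist_comm]; exact hlt⟩
  rw [← h] at hxball
  exact hx.2 hxball.1

/-- **The route delivers `AvoidanceValues`**: `AvoidanceLimit` (stmt-10649) gives the lattice
hull-avoidance limits `Φ'_A(0)^{5/8}` for the pulled-back `*`-hulls (chordal uniformizer by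
`MarkedDomain.exists_isChordalUniformizing_holds`, `IsStarHull.pullbackHull`, restriction data by
`IsStarHull.existsUnique_isRestrictionMap_holds` / `exists_hasRestrictionDeriv_holds` — all
THEOREMS), `SLEAvoidanceValue` (stmt-10651) identifies that value as the SLE(8/3) avoidance
probability (SLE law from `exists_isSLECurve_eightThirds`), and `AvoidancePassage` (stmt-4984)
sandwiches the limit `ν`. [folklore] -/
theorem avoidanceValues_of_routeItems (hA : AvoidanceLimit) (hP : AvoidancePassage)
    (hV : SLEAvoidanceValue) : AvoidanceValues := by
  intro D a b hab s ν hs hν hw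
  obtain ⟨Γ, hΓ⟩ := exists_isSLECurve_eightThirds D
  refine ⟨_, hΓ.isSLELaw_map, fun D' hsub h0 h1 hε => ?_⟩
  refine hP D a b hab s ν _ hs hν hw hΓ.isSLELaw_map ?_ D' hsub h0 h1 hε
  intro D'' hsub'' h0'' h1'' hε''
  obtain ⟨ε, hεpos, hb0, hb1⟩ := hε''
  obtain ⟨φ, hφ⟩ := MarkedDomain.exists_isChordalUniformizing_holds D
  have hHS : D.IsHullSubdomain D'' :=
    ⟨hsub'', h0'', h1'', notMem_closure_diff_of_ball_eq hεpos hb0,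
      notMem_closure_diff_of_ball_eq hεpos hb1⟩
  have hstar : IsStarHull (φ.pullbackHull D'') :=
    IsStarHull.pullbackHull JordanDomain.isSimplyConnected_holds hφ hHS
  obtain ⟨Φ, hΦ, -⟩ := IsStarHull.existsUnique_isRestrictionMap_holds hstar
  obtain ⟨d, -, -, hd⟩ := IsStarHull.exists_hasRestrictionDeriv_holds hstar hΦ
  have hlim := hA D D'' a b hab hsub'' h0'' h1'' ⟨ε, hεpos, hb0, hb1⟩ φ hφ (φ.pullbackHull D'')
    rfl Φ d hΦ hd
  have hval := hV D D'' _ hΓ.isSLELaw_map hsub'' h0'' h1'' ⟨ε, hεpos, hb0, hb1⟩ φ hφ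
    (φ.pullbackHull D'') rfl Φ d hΦ hd
  rw [hval]
  exact hlim.comp hs

/-! ## §5 Proved: the deterministic glue SHAPE + ORDER ⇒ simple -/

/-- **Argmax lemma** (ideator 3's `simple_of_arc_range_of_strictGrowth`, crux-ideate r1, kernel-
checked there and by triage r1-3 `CheckI3.lean`; vendored verbatim): if the range of `γ` is a simple
arc `e` with the same endpoints and the range STRICTLY GROWS on every nondegenerate parameter
interval, then `γ` is injective, so its class is simple (`f = e⁻¹ ∘ γ`; a dip of `f` below an
earlier maximum contradicts growth via the intermediate value theorem). [folklore] -/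
theorem simple_of_arc_range_of_strictGrowth (γ : Curve ℂ) (e : C(unitInterval, ℂ))
    (he : Function.Injective e) (hrange : Set.range e = γ.range)
    (h0 : e 0 = γ 0) (h1 : e 1 = γ 1)
    (hgrow : ∀ s t : unitInterval, s < t → ¬ (γ '' Set.Icc s t ⊆ γ '' Set.Icc 0 s)) :
    CurveClass.mk γ ∈ CurveClass.simple := by
  classical
  have _h1 := h1
  have hmem : ∀ t, γ t ∈ Set.range e := fun t => by rw [hrange]; exact ⟨t, rfl⟩
  let E : unitInterval ≃ Set.range e := Equiv.ofInjective e he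
  have hEcont : Continuous E := continuous_induced_rng.2 e.continuous
  have hEsymm : Continuous E.symm := Continuous.continuous_symm_of_equiv_compact_to_t2 hEcont
  let f : unitInterval → unitInterval := fun t => E.symm ⟨γ t, hmem t⟩
  have hγc : Continuous fun t : unitInterval => (⟨γ t, hmem t⟩ : Set.range e) :=
    continuous_induced_rng.2 γ.continuous
  have hf : Continuous f := hEsymm.comp hγc
  have hef : ∀ t, e (f t) = γ t := by
    intro t
    have h : ((E (f t) : Set.range e) : ℂ) = γ t := by
      show ((E (E.symm ⟨γ t, hmem t⟩) : Set.range e) : ℂ) = γ t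
      rw [Equiv.apply_symm_apply]
    rw [← h]
    rfl
  have hf0 : f 0 = 0 := he ((hef 0).trans h0.symm)
  -- real-valued copy of `f` and its extension to `ℝ` for the intermediate value theorem
  let F : unitInterval → ℝ := fun t => (f t : ℝ)
  have hF : Continuous F := continuous_subtype_val.comp hf
  let FR : ℝ → ℝ := F ∘ Set.projIcc (0 : ℝ) 1 zero_le_one
  have hFR : Continuous FR := hF.comp continuous_projIcc
  -- the key step: a point `ts < t₂` dominating `f` on `[0, t₂]` contradicts strict growth
  have key : ∀ ts t₂ : unitInterval, ts < t₂ → (∀ t : unitInterval, t ≤ t₂ → F t ≤ F ts) →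
      False := by
    intro ts t₂ hts hdom
    apply hgrow ts t₂ hts
    rintro _ ⟨t, ⟨hst, htt⟩, rfl⟩
    have hle : F t ≤ F ts := hdom t htt
    have hge : F 0 ≤ F t := by
      show ((f 0 : unitInterval) : ℝ) ≤ (f t : ℝ)
      rw [hf0]; exact (f t).2.1
    -- IVT for `FR` on `[0, ts]`
    have hts0 : (0 : ℝ) ≤ (ts : ℝ) := ts.2.1
    have hIVT := intermediate_value_Icc hts0 hFR.continuousOn
    have hFR0 : FR 0 = F 0 := by
      show F (Set.projIcc 0 1 zero_le_one 0) = F 0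
      rw [Set.projIcc_left]; rfl
    have hFRts : FR ts = F ts := by
      show F (Set.projIcc 0 1 zero_le_one (ts : ℝ)) = F ts
      rw [Set.projIcc_val]
    have hmemI : F t ∈ Set.Icc (FR 0) (FR ts) := by
      rw [hFR0, hFRts]; exact ⟨hge, hle⟩
    obtain ⟨x, hx, hxval⟩ := hIVT hmemI
    have hx01 : x ∈ Set.Icc (0 : ℝ) 1 := ⟨hx.1, hx.2.trans ts.2.2⟩
    set s : unitInterval := Set.projIcc 0 1 zero_le_one x with hs
    have hsx : (s : ℝ) = x := by rw [hs, Set.projIcc_of_mem _ hx01]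
    have hfs : f s = f t := by
      apply Subtype.ext
      show F s = F t
      have : FR x = F s := rfl
      rw [← this, hxval]
    refine ⟨s, ⟨bot_le, ?_⟩, ?_⟩
    · show (s : ℝ) ≤ (ts : ℝ)
      rw [hsx]; exact hx.2
    · rw [← hef, hfs, hef]
  have hmono : StrictMono f := by
    intro t₁ t₂ hlt
    by_contra hnot
    have hle : f t₂ ≤ f t₁ := not_lt.1 hnot
    have hS : IsClosed {t : unitInterval | (t : ℝ) ≤ (t₂ : ℝ)} :=
      isClosed_le continuous_subtype_val continuous_const
    obtain ⟨tm, htm, hmax⟩ :=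
      hS.isCompact.exists_isMaxOn ⟨t₂, show ((t₂ : unitInterval) : ℝ) ≤ t₂ from le_rfl⟩
        hF.continuousOn
    have htm' : tm ≤ t₂ := htm
    by_cases hlt2 : tm < t₂
    · exact key tm t₂ hlt2 (fun t ht => hmax (show ((t : unitInterval) : ℝ) ≤ t₂ from ht))
    · have htm2 : tm = t₂ := le_antisymm htm' (not_lt.1 hlt2)
      refine key t₁ t₂ hlt (fun t ht => ?_)
      have h1' : F t ≤ F tm := hmax (show ((t : unitInterval) : ℝ) ≤ t₂ from ht)
      have h2' : F t₂ ≤ F t₁ := by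
        show ((f t₂ : unitInterval) : ℝ) ≤ (f t₁ : ℝ)
        exact_mod_cast hle
      calc F t ≤ F tm := h1'
        _ = F t₂ := by rw [htm2]
        _ ≤ F t₁ := h2'
  have hinj : Function.Injective γ := by
    intro a b hab
    apply hmono.injective
    apply he
    rw [hef, hef]; exact hab
  exact CurveClass.mk_mem_simple hinj

/-- **No shadowing ⇒ strict range growth** for a LIGHT curve (no interval of constancy): if
`γ '' [s, t] ⊆ γ '' [0, s]` with `s < t`, lightness gives `u ∈ (s, t]` with `γ u ≠ γ s`; near `u`
the curve stays at distance `> d/2` from `γ s` (`d = |γ u - γ s|`), lightness again gives a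
sub-stretch of positive displacement there, and every point of it is a past point (`≤ s`) far from
`γ s` — an `(η, ρ)`-shadowing with `η, ρ ≥ 1/(k+1)` for some `k`. [folklore] -/
theorem strictGrowth_of_not_shadows (γ : Curve ℂ)
    (hlight : ∀ s t : I, s < t → ∃ u, s ≤ u ∧ u ≤ t ∧ γ u ≠ γ s)
    (hns : ∀ k : ℕ, ¬ Shadows γ (1 / ((k : ℝ) + 1)) (1 / ((k : ℝ) + 1))) :
    ∀ s t : I, s < t → ¬ (γ '' Set.Icc s t ⊆ γ '' Set.Icc 0 s) := by
  intro s t hst hsub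
  obtain ⟨u, hsu, hut, hne⟩ := hlight s t hst
  have hsu' : s < u := lt_of_le_of_ne hsu (fun h => hne (congrArg γ h).symm)
  set d : ℝ := dist (γ u) (γ s) with hd
  have hdpos : 0 < d := dist_pos.2 hne
  -- near `u` the curve stays far from `γ s`
  have hcont : ContinuousAt (fun x : I => dist (γ x) (γ s)) u :=
    (γ.continuous.dist continuous_const).continuousAt
  obtain ⟨τ, hτ, hτd⟩ : ∃ τ > 0, ∀ x : I, dist x u < τ → d / 2 < dist (γ x) (γ s) := by
    have hlt : d / 2 < dist (γ u) (γ s) := by rw [← hd]; linarith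
    have hev : ∀ᶠ x in 𝓝 u, d / 2 < dist (γ x) (γ s) := hcont.eventually (lt_mem_nhds hlt)
    obtain ⟨τ, hτ, hball⟩ := Metric.eventually_nhds_iff.1 hev
    exact ⟨τ, hτ, fun x hx => hball hx⟩
  -- the left end `u₁ = max s (u - τ/2)` of a short parameter interval ending at `u`
  have hsuR : (s : ℝ) < (u : ℝ) := Subtype.coe_lt_coe.2 hsu'
  have hu1mem : max (s : ℝ) ((u : ℝ) - τ / 2) ∈ Set.Icc (0 : ℝ) 1 :=
    ⟨le_max_of_le_left s.2.1, max_le s.2.2 (by linarith [u.2.2])⟩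
  set u₁ : I := ⟨max (s : ℝ) ((u : ℝ) - τ / 2), hu1mem⟩ with hu₁
  have hsu1 : s ≤ u₁ := Subtype.coe_le_coe.1 (le_max_left _ _)
  have hu1u : u₁ < u := Subtype.coe_lt_coe.1 (max_lt hsuR (by linarith))
  have hclose : ∀ x : I, u₁ ≤ x → x ≤ u → dist x u < τ := by
    intro x hx1 hx2
    have h1 : (u : ℝ) - τ / 2 ≤ (x : ℝ) := (le_max_right _ _).trans (Subtype.coe_le_coe.2 hx1)
    have h2 : (x : ℝ) ≤ (u : ℝ) := Subtype.coe_le_coe.2 hx2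
    rw [Subtype.dist_eq, Real.dist_eq, abs_sub_lt_iff]
    constructor <;> linarith
  -- lightness on `[u₁, u]`: a sub-stretch of positive displacement
  obtain ⟨w, hu1w, hwu, hwne⟩ := hlight u₁ u hu1u
  have hη₀ : 0 < dist (γ u₁) (γ w) := dist_pos.2 (Ne.symm hwne)
  obtain ⟨k, hk⟩ := exists_nat_one_div_lt (lt_min hη₀ (half_pos hdpos))
  apply hns k
  refine ⟨s, u₁, w, hsu1, hu1w, (hk.trans_le (min_le_left _ _)).le, ?_⟩
  intro x hx1 hx2
  have hxI : x ∈ Set.Icc s t := ⟨hsu1.trans hx1, hx2.trans (hwu.trans hut)⟩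
  obtain ⟨y, hy, hyx⟩ := hsub ⟨x, hxI, rfl⟩
  refine ⟨y, ⟨hy.2, ?_⟩, hyx⟩
  have hfar : d / 2 < dist (γ x) (γ s) := hτd x (hclose x hx1 (hx2.trans hwu))
  rw [hyx]
  exact ((hk.trans_le (min_le_right _ _)).trans hfar).le

/-- **SHAPE + ORDER ⇒ simple, for one class**: a class whose range is a simple arc with the same
endpoints and none of whose representatives `(1/(k+1), 1/(k+1))`-shadows its past (all `k`) is
simple — light representative (`Curve.exists_light_of_ne`, the class is non-constant because
`e 0 ≠ e 1`), strict growth (`strictGrowth_of_not_shadows`), argmax lemma. [folklore] -/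
theorem mem_simple_of_arc_of_notMem_shadowEvent (c : CurveClass ℂ) (e : C(I, ℂ))
    (he : Injective e) (hrange : range e = c.range) (h0 : e 0 = c.source) (h1 : e 1 = c.target)
    (hns : ∀ k : ℕ, c ∉ shadowEvent (1 / ((k : ℝ) + 1)) (1 / ((k : ℝ) + 1))) :
    c ∈ CurveClass.simple := by
  obtain ⟨γ₀, rfl⟩ := CurveClass.surjective_mk c
  have h01 : γ₀ 0 ≠ γ₀ 1 := by
    intro h
    have he01 : e 0 = e 1 := by
      rw [h0, h1, CurveClass.source_mk, CurveClass.target_mk, Curve.source_def, Curve.target_def]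
      exact h
    have h01' : ((0 : I) : ℝ) = ((1 : I) : ℝ) := congrArg Subtype.val (he he01)
    norm_num at h01'
  obtain ⟨γ, hγc, hγ0, hγ1, hlight, -⟩ := Curve.exists_light_of_ne h01
  have hnsγ : ∀ k : ℕ, ¬ Shadows γ (1 / ((k : ℝ) + 1)) (1 / ((k : ℝ) + 1)) :=
    fun k hk => hns k ⟨γ, hγc, hk⟩
  have hgrow := strictGrowth_of_not_shadows γ hlight hnsγ
  rw [← hγc]
  refine simple_of_arc_range_of_strictGrowth γ e he ?_ ?_ ?_ hgrow
  · rw [hrange, ← hγc, CurveClass.range_mk]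
  · rw [h0, CurveClass.source_mk, Curve.source_def, hγ0]
  · rw [h1, CurveClass.target_mk, Curve.target_def, hγ1]

/-! ## §6 The kernel-checked composition -/

/-! ### Name-keyed aliases of the two open stub statements (hypotheses of the composition)

`Registered.stub_X` is the statement of `stub_X` under the registered stub's short name, so that the
native skeleton audit (`#h21_check_skeleton`: hypotheses admissible iff registered obligations —
route items / declared stubs — BY NAME) accepts `SimpleSubseqLimits_of` (same device as
`Cruxes/BoundaryClosure/Lines/two-root-quotient.lean`). -/
namespace Registered

/-- Alias keyed by the registered stub name. -/
abbrev stub_rootReturn : Prop := RootReturn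
/-- Alias keyed by the registered stub name. -/
abbrev stub_slitShadowDecay : Prop := SlitShadowDecay

end Registered

/-- **Class-level shadow decay IS the polyline-level one** (glue, proved): the lattice event
`{γ | γ.curve ∈ nearShadowEvent η ρ ε}` equals `{γ | NearShadows (latticeCurve γ) η ρ ε}` — open sets
of curves are saturated for distance zero (`ShadowPassage.setOf_nearShadows_latticeCurve`, landed by
the second lead of `marked-point-revisit`). [folklore] -/
theorem shadowDecay_of_polyline (hP : PolylineShadowDecay) : ShadowDecay := by
  intro D a b hab η ρ θ hη hρ hθ
  obtain ⟨ε, hε, hev⟩ := hP D a b hab η ρ θ hη hρ hθ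
  refine ⟨ε, hε, ?_⟩
  filter_upwards [hev] with δ hδ
  have key : {γ : DomainSAW D.carrier δ (a δ) (b δ) | NearShadows (latticeCurve γ) η ρ ε} =
      {γ | γ.curve ∈ nearShadowEvent η ρ ε} :=
    Summit.CriticalPhenomena.SAWScalingLimit.Theorems.SimpleSubseqLimits.MarkedPointRevisit.ShadowPassage.setOf_nearShadows_latticeCurve
      η ρ ε
  rw [← key]
  exact hδ

/-- **The line concludes the crux BY NAME** (`<Crux>_of`, sorry-free; axioms propext /
Classical.choice / Quot.sound).  Hypotheses: the two registered (open) stub statements and the three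
route items `AvoidanceLimit` (stmt-10649), `AvoidancePassage` (stmt-4984), `SLEAvoidanceValue`
(stmt-10651) by name.  ORDER: stubs 1, 2 → the landed decomposition `stub_decomposition` (polyline decay) → class decay (`shadowDecay_of_polyline`) → limit passage give `NoShadowing`; SHAPE: the route items give
`AvoidanceValues` (`avoidanceValues_of_routeItems`), stub 1 gives `RangeArc`; the landed core
equivalence reduces the crux to `ν`-a.s. simple ∧ boundary-avoiding; the boundary clause is in
`RangeArc`, and simplicity is `mem_simple_of_arc_of_notMem_shadowEvent` applied `ν`-a.e. (countably
many null shadow events, free endpoint clauses for `e 0 = source`, `e 1 = target`). -/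
theorem SimpleSubseqLimits_of (h₂ : Registered.stub_rootReturn) (h₃ : Registered.stub_slitShadowDecay)
    (hA : AvoidanceLimit) (hP : AvoidancePassage) (hV : SLEAvoidanceValue) :
    Summit.CriticalPhenomena.SAWScalingLimit.Theses.SAWLoopFugacityFlow.SimpleSubseqLimits := by
  have hNS : NoShadowing := stub_limitPassage (shadowDecay_of_polyline (stub_decomposition h₂ h₃))
  have hRA : RangeArc := stub_rangeArc (avoidanceValues_of_routeItems hA hP hV)
  refine simpleSubseqLimits_iff_core.2 fun D a b hab s ν hs hν hw => ?_
  have hra := hRA D a b hab s ν hs hν hw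
  have hfree := ae_source_target_range_of_weakLimitAlong hab hs hw
  have hns : ∀ k : ℕ, ∀ᵐ c ∂ν, c ∉ shadowEvent (1 / ((k : ℝ) + 1)) (1 / ((k : ℝ) + 1)) :=
    fun k => measure_eq_zero_iff_ae_notMem.1
      (hNS D a b hab s ν hs hν hw _ _ (by positivity) (by positivity))
  rw [← ae_all_iff] at hns
  filter_upwards [hra, hfree, hns] with c hc hf hn
  obtain ⟨⟨e, he, hrange, he0, he1⟩, hfr⟩ := hc
  exact ⟨mem_simple_of_arc_of_notMem_shadowEvent c e he hrange (he0.trans hf.1.symm)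
    (he1.trans hf.2.1.symm) hn, hfr⟩

/-- Wiring check: the registered stubs feed `SimpleSubseqLimits_of` as stated (the proof of the
item modulo the two open stubs and the three route items). -/
example (hA : AvoidanceLimit) (hP : AvoidancePassage) (hV : SLEAvoidanceValue) :
    Summit.CriticalPhenomena.SAWScalingLimit.Theses.SAWLoopFugacityFlow.SimpleSubseqLimits :=
  SimpleSubseqLimits_of stub_rootReturn stub_slitShadowDecay hA hP hV

/-! ## §7 The two open inputs ARE the crux, modulo tightness and the A-side (landed pins) -/

/-- **Equivalence.** Under `EventualTight` (stmt-CriticalPhenomena-1372) and the three route items,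
`SimpleSubseqLimits ↔ RootReturn ∧ SlitShadowDecay`: `→` by the landed pins
`RootReturnPinned.inputs_of_crux` (thickening necessity, p84995), `←` by `SimpleSubseqLimits_of` above with
the landed decomposition discharged (the importable form is `PastShadowing.Main.line_main`, `Theorems/…PSLine.lean`).
So stubs 1 and 2 are not a weakening of the crux but its lattice re-expression, root part and G-type
part separated. [folklore] -/
theorem crux_iff_inputs (hT : EventualTight) (hA : AvoidanceLimit) (hP : AvoidancePassage)
    (hV : SLEAvoidanceValue) : SimpleSubseqLimits ↔ (RootReturn ∧ SlitShadowDecay) :=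
  ⟨fun hS =>
    Summit.CriticalPhenomena.SAWScalingLimit.Theorems.SimpleSubseqLimits.PastShadowing.RootReturnPinned.inputs_of_crux hT hS,
    fun h => SimpleSubseqLimits_of h.1 h.2 hA hP hV⟩

/-- **Both inputs are implied by the summit conjecture** (landed `RootReturnPinned.inputs_of_sawScalingLimit`). [folklore] -/
theorem inputs_of_sawScalingLimit (h : _root_.SAWScalingLimit) : RootReturn ∧ SlitShadowDecay :=
  Summit.CriticalPhenomena.SAWScalingLimit.Theorems.SimpleSubseqLimits.PastShadowing.RootReturnPinned.inputs_of_sawScalingLimit h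

end Summit.CriticalPhenomena.SAWScalingLimit.Cruxes.SimpleSubseqLimits.PastShadowingCostsHalves

end
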